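import Summits.AtomisticToContinuum.Crystallization.Theorems.ChartedZeroExcessLayeredLatticeLiouvilleZZZA
import Summits.AtomisticToContinuum.Crystallization.Theorems.ChartedZeroExcessLayeredLatticeLiouvilleZZT

/-!
# (B′.6b) rider ZZZB — PIN EXTENSION WITHOUT C-SIDE DIALS (`pin_extension_reg`)

Lineage `stmt-AtomisticToContinuum-26636` (route ChartedPlanarOrder), lens-2 g81, FINDING «IC» §F3.  Imports rider ZZZA (`pin_step_reg`) and
tree ZZT (`pin_extension`: the cone facts `dist_lt_dist_of_cone` / `infDist_lt_infDist_of_cone`, and tree ZZE `pin_induction` through it).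

★★ `pin_extension_reg` — tree ZZT `pin_extension` VERBATIM (symbolic zone dials `(q, r, ℓ, ρ)`, potential `d(Ψ ·, K)`, downward induction over
the finite shallow set `T`, known band `ρ < d ≤ ρ + 43/20`), with LEMMA C's goodness binder `hgood` and the dial block `hϑ haLo hbond hlo hhi`
REPLACED by the registration of the twelve link sites of every shallow site (`hreg`), consumed by ZZZA `pin_step_reg`.
★ `pin_extension_reg_of_moat` — the form the junction uses: registration is known on an INNER moat `moatIn S K r₀ ℓ₀` up to the landing bound
(REG-out of the cool shadow crystal, `r₀ = 8`), and the pin zone is the moat `moatIn S K r ℓ` with `r₀ + βS ≤ r`, `ℓ ≤ ℓ₀`, `ρ + βS < ℓ₀`: then both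
the landing-zone partners (`hA`) and the link registrations (`hreg`) follow (a link site of a shallow site is an `S`-bond `≤ βS` away).
★ `pin_extension_reg_record` — record dials `(q, r₀, ℓ, ρ) = (4, 8, 43/2, 179/16)`, bond gap `βS ≤ 17/16`, and the SMALLEST pin-zone radius the
transport serves, `r = 145/16 = 8 + 17/16`: `g = Θ` on `{y : Ψ y ∈ moatIn S K (145/16) (43/2), d(Ψ y, K) ≤ 1067/80}`.  The inner collar `(8, 145/16]` is
FINDING «IC» §F4 (not addressed here).

0 sorry; no new definitions; no new real-side estimate.
-/

noncomputable section
open scoped RealInnerProductSpace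
open Literature.Geometry.DiscreteGeometry (IsTwoShellGoodSet)

namespace Summit.AtomisticToContinuum.Crystallization.Theorems.ChartedZeroExcessLayeredLatticeLiouville

open Summit.AtomisticToContinuum.Crystallization.Theorems.ChartedPlanarOrderRigidityDoor (E3)

/-- ★★ **PIN EXTENSION, REGISTRATION FORM.**  Tree ZZT `pin_extension` with `hgood hϑ haLo hbond hlo hhi` replaced by `hreg` (the twelve link
sites of every shallow site are registered). [this file, g81] -/
theorem pin_extension_reg {S C K : Set E3} {D N : Set (ℤ × ℤ × ℤ)} {Ψ Φ : ℤ × ℤ × ℤ → E3} {τ τ' : ℤ → Bool}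
    {g Θ : ℤ × ℤ × ℤ → ℤ × ℤ × ℤ} {ε δS βS q r ℓ ρ : ℝ} {x₀ : E3} (T : Finset (ℤ × ℤ × ℤ))
    (hΨ : IsBarlowBondChart S Set.univ Ψ τ) (hclean : ∀ p ∈ S, IsTwoShellGoodSet (1 / 16) (9 / 10) 1 S p)
    (hsepS : ∀ p ∈ S, ∀ p' ∈ S, p ≠ p' → δS ≤ dist p p') (hε : 2 * ε < δS)
    (hgapS : ∀ p ∈ S, ∀ p' ∈ S, IsBond p p' → dist p p' ≤ βS) (hβS : βS + 2 * ε ≤ 28 / 25)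
    (hΦ : IsBarlowBondChart C D Φ τ')
    (hlo' : 28 / 25 + 2 * ε < 9 / 10 * (Real.sqrt 2 - 1 / 16))
    (hKfin : K.Finite) (hKne : K.Nonempty) (hqr : 2 * q ≤ r) (hK : ∀ k ∈ K, dist k x₀ ≤ q)
    (hℓ : ρ + 43 / 20 < ℓ)
    (hA : ∀ y, Ψ y ∈ moatIn S K r ℓ → Metric.infDist (Ψ y) K ≤ ρ + 43 / 20 →
      g y ∈ D ∧ dist (Ψ y) (Φ (g y)) ≤ ε)
    (hknown : ∀ y, Ψ y ∈ moatIn S K r ℓ → ρ < Metric.infDist (Ψ y) K →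
      Metric.infDist (Ψ y) K ≤ ρ + 43 / 20 → g y = Θ y)
    (hT : ∀ x, Ψ x ∈ moatIn S K r ℓ → Metric.infDist (Ψ x) K ≤ ρ → x ∈ T)
    (hreg : ∀ x, Ψ x ∈ moatIn S K r ℓ → Metric.infDist (Ψ x) K ≤ ρ →
      ∀ i, g (linkPt τ x i) ∈ D ∧ dist (Ψ (linkPt τ x i)) (Φ (g (linkPt τ x i))) ≤ ε)
    (hN : ∀ x, Ψ x ∈ moatIn S K r ℓ → Metric.infDist (Ψ x) K ≤ ρ →
      (∀ i, linkPt τ x i ∈ N) ∧ (∀ i j, linkPt τ (linkPt τ x i) j ∈ N) ∧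
        ∀ i j k, linkPt τ (linkPt τ (linkPt τ x i) j) k ∈ N)
    (hiso : ∀ y y' : ℤ × ℤ × ℤ, y ∈ N → (BarlowAdj τ y y' ↔ BarlowAdj τ' (Θ y) (Θ y')))
    (hsurj : ∀ y ∈ N, ∀ v : ℤ × ℤ × ℤ, BarlowAdj τ' (Θ y) v → ∃ y', Θ y' = v) :
    ∀ x, Ψ x ∈ moatIn S K r ℓ → Metric.infDist (Ψ x) K ≤ ρ + 43 / 20 → g x = Θ x := by
  have main : ∀ x ∈ T, Ψ x ∈ moatIn S K r ℓ → Metric.infDist (Ψ x) K ≤ ρ → g x = Θ x := by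
    refine pin_induction T (fun y => Metric.infDist (Ψ y) K)
      (Good := fun x => Ψ x ∈ moatIn S K r ℓ → Metric.infDist (Ψ x) K ≤ ρ → g x = Θ x)
      fun x hxT ih hxm hxρ => ?_
    obtain ⟨hxD, hxd⟩ := hA x hxm (by linarith)
    have hregx := hreg x hxm hxρ
    obtain ⟨hN1, hN2, hN3⟩ := hN x hxm hxρ
    have hxS : Ψ x ∈ S := hxm.1
    have hfar : ∀ k ∈ K, r < dist (Ψ x) k := hxm.2.2
    have hw : Ψ x ≠ x₀ := by
      intro h
      obtain ⟨k, hk⟩ := hKne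
      have h1 := hfar k hk
      have h2 := hK k hk
      rw [h, dist_comm] at h1
      have h3 : (0 : ℝ) ≤ dist k x₀ := dist_nonneg
      linarith
    refine pin_step_reg (P := {y | Ψ y ∈ moatIn S K r ℓ ∧ Metric.infDist (Ψ y) K ≤ ρ + 43 / 20 ∧ g y = Θ y})
      hΨ hclean hsepS hε hgapS hβS hΦ hxD hxd hregx hlo'
      (fun y hy => ⟨hy.2.2, hA y hy.1 hy.2.1⟩) hiso hsurj hN1 hN2 hN3 hw fun y hc hpos hle => ?_
    have hyS : Ψ y ∈ S := hΨ.2.1 (Set.mem_univ y)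
    obtain ⟨hgain, hlip⟩ := infDist_lt_infDist_of_cone hKfin hKne hqr hK hfar hc hpos
    have hland : Metric.infDist (Ψ y) K ≤ ρ + 43 / 20 := by linarith
    have hym : Ψ y ∈ moatIn S K r ℓ := by
      obtain ⟨k, hk, he⟩ := hKfin.isCompact.exists_infDist_eq_dist hKne (Ψ x)
      refine ⟨hyS, ⟨k, hk, ?_⟩, fun k' hk' => ?_⟩
      · calc dist (Ψ y) k ≤ dist (Ψ y) (Ψ x) + dist (Ψ x) k := dist_triangle _ _ _
          _ ≤ 43 / 20 + ρ := add_le_add hle (he ▸ hxρ)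
          _ < ℓ := by linarith
      · have hkp : r ≤ dist k' (Ψ x) := by rw [dist_comm]; exact (hfar k' hk').le
        exact (hfar k' hk').trans (dist_lt_dist_of_cone hqr (hK k' hk') hkp hc hpos)
    refine ⟨hym, hland, ?_⟩
    by_cases hyρ : Metric.infDist (Ψ y) K ≤ ρ
    · exact ih y (hT y hym hyρ) hgain hym hyρ
    · exact hknown y hym (lt_of_not_ge hyρ) hland
  intro x hxm hx
  by_cases hxρ : Metric.infDist (Ψ x) K ≤ ρ
  · exact main x (hT x hxm hxρ) hxm hxρ
  · exact hknown x hxm (lt_of_not_ge hxρ) hx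

/-- a link site of a moat site whose potential is `≤ ρ` lies in the inner moat `(r₀, ℓ₀)` with potential `≤ ρ + 43/20`, when `r₀ + βS ≤ r`,
`ρ + βS < ℓ₀`, `βS ≤ 43/20` (one bond). [formal bookkeeping] -/
theorem linkPt_mem_moatIn {S K : Set E3} {Ψ : ℤ × ℤ × ℤ → E3} {τ : ℤ → Bool} {βS r₀ r ℓ ℓ₀ ρ : ℝ}
    (hΨ : IsBarlowBondChart S Set.univ Ψ τ) (hgapS : ∀ p ∈ S, ∀ p' ∈ S, IsBond p p' → dist p p' ≤ βS)
    (hβ : βS ≤ 43 / 20) (hKfin : K.Finite) (hKne : K.Nonempty)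
    (hr₀ : r₀ + βS ≤ r) (hρ₀ : ρ + βS < ℓ₀) {x : ℤ × ℤ × ℤ} (hxm : Ψ x ∈ moatIn S K r ℓ)
    (hxρ : Metric.infDist (Ψ x) K ≤ ρ) (i : Fin 12) :
    Ψ (linkPt τ x i) ∈ moatIn S K r₀ ℓ₀ ∧ Metric.infDist (Ψ (linkPt τ x i)) K ≤ ρ + 43 / 20 := by
  have hxS : Ψ x ∈ S := hxm.1
  have hzS : Ψ (linkPt τ x i) ∈ S := hΨ.2.1 (Set.mem_univ _)
  have hb : IsBond (Ψ x) (Ψ (linkPt τ x i)) :=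
    (hΨ.2.2 x (Set.mem_univ _) (linkPt τ x i) (Set.mem_univ _)).2 (barlowAdj_linkPt τ x i)
  have hdz : dist (Ψ x) (Ψ (linkPt τ x i)) ≤ βS := hgapS _ hxS _ hzS hb
  obtain ⟨k, hk, he⟩ := hKfin.isCompact.exists_infDist_eq_dist hKne (Ψ x)
  refine ⟨⟨hzS, ⟨k, hk, ?_⟩, fun k' hk' => ?_⟩, ?_⟩
  · calc dist (Ψ (linkPt τ x i)) k ≤ dist (Ψ (linkPt τ x i)) (Ψ x) + dist (Ψ x) k := dist_triangle _ _ _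
      _ ≤ βS + ρ := by rw [dist_comm]; exact add_le_add hdz (he ▸ hxρ)
      _ < ℓ₀ := by linarith
  · have h1 := hxm.2.2 k' hk'
    have h2 := dist_triangle (Ψ x) (Ψ (linkPt τ x i)) k'
    linarith
  · calc Metric.infDist (Ψ (linkPt τ x i)) K ≤ Metric.infDist (Ψ x) K + dist (Ψ (linkPt τ x i)) (Ψ x) :=
          Metric.infDist_le_infDist_add_dist
      _ ≤ ρ + βS := by rw [dist_comm]; exact add_le_add hxρ hdz
      _ ≤ ρ + 43 / 20 := by linarith

/-- ★ **PIN EXTENSION FROM AN INNER REGISTRATION MOAT** (the junction's form).  Registration (`ε`-partners in `D`) is known on the inner moat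
`moatIn S K r₀ ℓ₀` up to the landing bound `ρ + 43/20`; the pin zone is the moat `moatIn S K r ℓ` with `r₀ ≤ r`, `r₀ + βS ≤ r`, `ℓ ≤ ℓ₀`,
`ρ + βS < ℓ₀` (`βS ≤ 43/20` a bond bound); everything else as in `pin_extension_reg`. [this file, g81] -/
theorem pin_extension_reg_of_moat {S C K : Set E3} {D N : Set (ℤ × ℤ × ℤ)} {Ψ Φ : ℤ × ℤ × ℤ → E3} {τ τ' : ℤ → Bool}
    {g Θ : ℤ × ℤ × ℤ → ℤ × ℤ × ℤ} {ε δS βS q r₀ r ℓ ℓ₀ ρ : ℝ} {x₀ : E3} (T : Finset (ℤ × ℤ × ℤ))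
    (hΨ : IsBarlowBondChart S Set.univ Ψ τ) (hclean : ∀ p ∈ S, IsTwoShellGoodSet (1 / 16) (9 / 10) 1 S p)
    (hsepS : ∀ p ∈ S, ∀ p' ∈ S, p ≠ p' → δS ≤ dist p p') (hε : 2 * ε < δS)
    (hgapS : ∀ p ∈ S, ∀ p' ∈ S, IsBond p p' → dist p p' ≤ βS) (hβS : βS + 2 * ε ≤ 28 / 25) (hβS' : βS ≤ 43 / 20)
    (hΦ : IsBarlowBondChart C D Φ τ')
    (hlo' : 28 / 25 + 2 * ε < 9 / 10 * (Real.sqrt 2 - 1 / 16))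
    (hKfin : K.Finite) (hKne : K.Nonempty) (hqr : 2 * q ≤ r) (hK : ∀ k ∈ K, dist k x₀ ≤ q)
    (hℓ : ρ + 43 / 20 < ℓ) (hrr : r₀ ≤ r) (hr₀ : r₀ + βS ≤ r) (hℓℓ : ℓ ≤ ℓ₀) (hρ₀ : ρ + βS < ℓ₀)
    (hA₀ : ∀ y, Ψ y ∈ moatIn S K r₀ ℓ₀ → Metric.infDist (Ψ y) K ≤ ρ + 43 / 20 →
      g y ∈ D ∧ dist (Ψ y) (Φ (g y)) ≤ ε)
    (hknown : ∀ y, Ψ y ∈ moatIn S K r ℓ → ρ < Metric.infDist (Ψ y) K →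
      Metric.infDist (Ψ y) K ≤ ρ + 43 / 20 → g y = Θ y)
    (hT : ∀ x, Ψ x ∈ moatIn S K r ℓ → Metric.infDist (Ψ x) K ≤ ρ → x ∈ T)
    (hN : ∀ x, Ψ x ∈ moatIn S K r ℓ → Metric.infDist (Ψ x) K ≤ ρ →
      (∀ i, linkPt τ x i ∈ N) ∧ (∀ i j, linkPt τ (linkPt τ x i) j ∈ N) ∧
        ∀ i j k, linkPt τ (linkPt τ (linkPt τ x i) j) k ∈ N)
    (hiso : ∀ y y' : ℤ × ℤ × ℤ, y ∈ N → (BarlowAdj τ y y' ↔ BarlowAdj τ' (Θ y) (Θ y')))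
    (hsurj : ∀ y ∈ N, ∀ v : ℤ × ℤ × ℤ, BarlowAdj τ' (Θ y) v → ∃ y', Θ y' = v) :
    ∀ x, Ψ x ∈ moatIn S K r ℓ → Metric.infDist (Ψ x) K ≤ ρ + 43 / 20 → g x = Θ x := by
  have hsub : ∀ y, Ψ y ∈ moatIn S K r ℓ → Ψ y ∈ moatIn S K r₀ ℓ₀ := by
    intro y hy
    obtain ⟨hyS, ⟨k, hk, hkℓ⟩, hfar⟩ := hy
    exact ⟨hyS, ⟨k, hk, lt_of_lt_of_le hkℓ hℓℓ⟩, fun k' hk' => lt_of_le_of_lt hrr (hfar k' hk')⟩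
  exact pin_extension_reg T hΨ hclean hsepS hε hgapS hβS hΦ hlo' hKfin hKne hqr hK hℓ
    (fun y hy hd => hA₀ y (hsub y hy) hd) hknown hT
    (fun x hxm hxρ i => by
      obtain ⟨hm, hd⟩ := linkPt_mem_moatIn hΨ hgapS hβS' hKfin hKne hr₀ hρ₀ hxm hxρ i
      exact hA₀ _ hm hd)
    hN hiso hsurj

/-- ★ **RECORD FORM** `(q, r₀, ℓ, ρ) = (4, 8, 43/2, 179/16)`, bond gap `βS ≤ 17/16` (ZZU's binders), pin zone from `r = 145/16 = 8 + 17/16` (the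
smallest radius the transport serves), landing bound `1067/80`, known band `(179/16, 1067/80]`; registration on the record moat `moatIn S K 8 (43/2)`
up to the landing bound. [this file, g81] -/
theorem pin_extension_reg_record {S C K : Set E3} {D N : Set (ℤ × ℤ × ℤ)} {Ψ Φ : ℤ × ℤ × ℤ → E3}
    {τ τ' : ℤ → Bool} {g Θ : ℤ × ℤ × ℤ → ℤ × ℤ × ℤ} {ε δS βS : ℝ} {x₀ : E3}
    (T : Finset (ℤ × ℤ × ℤ))
    (hΨ : IsBarlowBondChart S Set.univ Ψ τ) (hclean : ∀ p ∈ S, IsTwoShellGoodSet (1 / 16) (9 / 10) 1 S p)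
    (hsepS : ∀ p ∈ S, ∀ p' ∈ S, p ≠ p' → δS ≤ dist p p') (hε : 2 * ε < δS)
    (hgapS : ∀ p ∈ S, ∀ p' ∈ S, IsBond p p' → dist p p' ≤ βS) (hβS : βS + 2 * ε ≤ 28 / 25)
    (hβS' : βS ≤ 17 / 16)
    (hΦ : IsBarlowBondChart C D Φ τ')
    (hlo' : 28 / 25 + 2 * ε < 9 / 10 * (Real.sqrt 2 - 1 / 16))
    (hKfin : K.Finite) (hKne : K.Nonempty) (hK : ∀ k ∈ K, dist k x₀ ≤ 4)
    (hA₀ : ∀ y, Ψ y ∈ moatIn S K 8 (43 / 2) → Metric.infDist (Ψ y) K ≤ 1067 / 80 →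
      g y ∈ D ∧ dist (Ψ y) (Φ (g y)) ≤ ε)
    (hknown : ∀ y, Ψ y ∈ moatIn S K (145 / 16) (43 / 2) → 179 / 16 < Metric.infDist (Ψ y) K →
      Metric.infDist (Ψ y) K ≤ 1067 / 80 → g y = Θ y)
    (hT : ∀ x, Ψ x ∈ moatIn S K (145 / 16) (43 / 2) → Metric.infDist (Ψ x) K ≤ 179 / 16 → x ∈ T)
    (hN : ∀ x, Ψ x ∈ moatIn S K (145 / 16) (43 / 2) → Metric.infDist (Ψ x) K ≤ 179 / 16 →
      (∀ i, linkPt τ x i ∈ N) ∧ (∀ i j, linkPt τ (linkPt τ x i) j ∈ N) ∧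
        ∀ i j k, linkPt τ (linkPt τ (linkPt τ x i) j) k ∈ N)
    (hiso : ∀ y y' : ℤ × ℤ × ℤ, y ∈ N → (BarlowAdj τ y y' ↔ BarlowAdj τ' (Θ y) (Θ y')))
    (hsurj : ∀ y ∈ N, ∀ v : ℤ × ℤ × ℤ, BarlowAdj τ' (Θ y) v → ∃ y', Θ y' = v) :
    ∀ x, Ψ x ∈ moatIn S K (145 / 16) (43 / 2) → Metric.infDist (Ψ x) K ≤ 1067 / 80 → g x = Θ x := by
  have h := pin_extension_reg_of_moat (q := 4) (r₀ := 8) (r := 145 / 16) (ℓ := 43 / 2) (ℓ₀ := 43 / 2)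
    (ρ := 179 / 16) T hΨ hclean hsepS hε hgapS hβS (by linarith) hΦ hlo' hKfin hKne (by norm_num) hK (by norm_num)
    (by norm_num) (by linarith) le_rfl (by linarith)
    (fun y hy hd => hA₀ y hy (by norm_num at hd ⊢; exact hd))
    (fun y hy h1 h2 => hknown y hy h1 (by norm_num at h2 ⊢; exact h2)) hT hN hiso hsurj
  intro x hxm hx
  exact h x hxm (by norm_num; exact hx)

end Summit.AtomisticToContinuum.Crystallization.Theorems.ChartedZeroExcessLayeredLatticeLiouville

end
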